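import Mathlib
import HarnessLib

/-!
# `NoHeavyLowerTail` (crux stmt-CriticalPhenomena-4575), antithetic vdBHK programme: TWINNING THE ROOT preserves the twin slack inequality —
# the ROOT-TWIN IDENTITY (THEOREM T4 of FINDING-TWIN-g56.md §3b)

Support file (seat `prim-ineq-gen-7` gen 56; `--supports stmt-CriticalPhenomena-4575`).  No `sorry`, no definitions.  Companion of `AntitheticTwin`,
`AntitheticTwinTransfer`.  Memo: run/shared/lean/prim/prim-ineq-gen-7/FINDING-TWIN-g56.md §2, §3b.

SETTING.  `U` is a finite type (the colourings of `Q ∖ d` for a rooted poset `(Q,d)`), `j : U → U` any map (the colour swap), and all data are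
indicator-like functions `U → ℤ`: an up-set of the twin poset `Ω_{Q+d′}` (`d′` a twin of the ROOT `d`) is a quadruple of fibre traces `(a₀, v, v′, a₁)`
(TWIN STRUCTURE THEOREM, `AntitheticTwin` / `AntitheticTwinTransfer`), where for the twin slack inequality of the ROOTED twin `(Q+d′, d)` one uses
`a₀ := 1_{↑_M A₀} ≤ v, v′ ≤ a₁ := 1_{int_M A₁}` (`M` the dead order).  Write `P(f,g) := Σ_x f(x)·g(j x)`.  The antipodal room overlap of the rooted twin is
`P(v′ − a₀, b₁ − w) + P(a₁ − v, w′ − b₀)` (memo §3b (T4): `d′` is a live isolated atom for `(Q+d′, d)`, so the dead order is `M × (red<blue)`), the transfer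
term of the twin decomposition is `P(v − v′, w − w′)`, and the room overlap of the base is `P(a₁ − a₀, b₁ − b₀)`.
* `AntitheticTwinRoot.root_twin_pointwise` — the polynomial identity behind (T4), for arbitrary integers.
* `AntitheticTwinRoot.root_twin_identity` — **(T4), identity form**:  `P(a₁−a₀, b₁−b₀) + P(v−v′, w−w′) = P(v′−a₀, b₁−w) + P(a₁−v, w′−b₀) + P(a₁−v′, b₁−w′) +
  P(v−a₀, w−b₀)` for arbitrary functions `U → ℤ` and any `j`.
* `AntitheticTwinRoot.root_twin_transfer` — **(T4), inequality form**: if `a₀ ≤ v`, `v′ ≤ a₁`, `b₀ ≤ w`, `w′ ≤ b₁` pointwise, the base satisfies its twin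
  slack inequality `AKQ ≥ P(a₁−a₀, b₁−b₀)` and the two middle antipodal-Kleitman slacks `AKV, AKV′` are `≥ 0`, then the rooted twin satisfies its twin slack
  inequality: `AKQ + AKV + AKV′ + P(v−v′, w−w′) ≥ P(v′−a₀, b₁−w) + P(a₁−v, w′−b₀)`.  CONSEQUENCE (memo §3b): the class of TSI-good rooted posets is closed under
  twinning the root; with root insertions (T3′) this gives `Ω_{A_k ⊕ R}` antipodal Kleitman for every `k ≥ 1` and every finite poset `R`.
-/

namespace Summit.CriticalPhenomena.PercolationContinuityZ3.Theorems

open Finset BigOperators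

namespace AntitheticTwinRoot

/-- The polynomial identity behind the root-twin theorem: for arbitrary integers (the values at a point `x` and at `j x`),
`(a₁−a₀)(b₁−b₀) + (v−v′)(w−w′) = (v′−a₀)(b₁−w) + (a₁−v)(w′−b₀) + (a₁−v′)(b₁−w′) + (v−a₀)(w−b₀)`. [this work] -/
theorem root_twin_pointwise (a₀ v v' a₁ b₀ w w' b₁ : ℤ) :
    (a₁ - a₀) * (b₁ - b₀) + (v - v') * (w - w') =
      (v' - a₀) * (b₁ - w) + (a₁ - v) * (w' - b₀) + (a₁ - v') * (b₁ - w') + (v - a₀) * (w - b₀) := by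
  ring

/-- **ROOT-TWIN IDENTITY (T4, identity form).**  For arbitrary functions `a₀ v v′ a₁ b₀ w w′ b₁ : U → ℤ` on a finite type and any map `j : U → U`, with
`P(f,g) = Σ_x f x * g (j x)`:  `P(a₁−a₀, b₁−b₀) + P(v−v′, w−w′) = P(v′−a₀, b₁−w) + P(a₁−v, w′−b₀) + P(a₁−v′, b₁−w′) + P(v−a₀, w−b₀)`. [this work] -/
theorem root_twin_identity {U : Type*} [Fintype U] (j : U → U) (a₀ v v' a₁ b₀ w w' b₁ : U → ℤ) :
    (∑ x, (a₁ x - a₀ x) * (b₁ (j x) - b₀ (j x))) + (∑ x, (v x - v' x) * (w (j x) - w' (j x))) =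
      (∑ x, (v' x - a₀ x) * (b₁ (j x) - w (j x))) + (∑ x, (a₁ x - v x) * (w' (j x) - b₀ (j x))) +
        (∑ x, (a₁ x - v' x) * (b₁ (j x) - w' (j x))) + (∑ x, (v x - a₀ x) * (w (j x) - b₀ (j x))) := by
  rw [← Finset.sum_add_distrib, ← Finset.sum_add_distrib, ← Finset.sum_add_distrib, ← Finset.sum_add_distrib]
  refine Finset.sum_congr rfl fun x _ => ?_
  exact root_twin_pointwise (a₀ x) (v x) (v' x) (a₁ x) (b₀ (j x)) (w (j x)) (w' (j x)) (b₁ (j x))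

/-- **ROOT-TWIN TRANSFER (T4, inequality form).**  Pointwise `a₀ ≤ v`, `v′ ≤ a₁`, `b₀ ≤ w`, `w′ ≤ b₁` (for the fibre traces of two up-sets of the twin of a
ROOTED poset at its root one has `a₀ = 1_{↑A₀} ≤ v, v′ ≤ a₁ = 1_{int A₁}`; only these four of the eight nestings are needed); the base satisfies its twin slack inequality
`P(a₁−a₀, b₁−b₀) ≤ AKQ` (`hTSI`) and the two middle antipodal-Kleitman slacks are nonnegative (`hV`, `hV'`).  Then the rooted twin satisfies its twin slack
inequality: the room overlap `P(v′−a₀, b₁−w) + P(a₁−v, w′−b₀)` is at most `AKQ + AKV + AKV′ + P(v−v′, w−w′)` (= the antipodal-Kleitman sum of the twin in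
the decomposition of `AntitheticTwinTransfer`). [this work] -/
theorem root_twin_transfer {U : Type*} [Fintype U] (j : U → U) (a₀ v v' a₁ b₀ w w' b₁ : U → ℤ) (AKQ AKV AKV' : ℤ)
    (h1 : ∀ x, a₀ x ≤ v x) (h4 : ∀ x, v' x ≤ a₁ x) (k1 : ∀ x, b₀ x ≤ w x) (k4 : ∀ x, w' x ≤ b₁ x)
    (hTSI : (∑ x, (a₁ x - a₀ x) * (b₁ (j x) - b₀ (j x))) ≤ AKQ) (hV : 0 ≤ AKV) (hV' : 0 ≤ AKV') :
    (∑ x, (v' x - a₀ x) * (b₁ (j x) - w (j x))) + (∑ x, (a₁ x - v x) * (w' (j x) - b₀ (j x))) ≤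
      AKQ + AKV + AKV' + ∑ x, (v x - v' x) * (w (j x) - w' (j x)) := by
  have hid := root_twin_identity j a₀ v v' a₁ b₀ w w' b₁
  have p1 : 0 ≤ ∑ x, (a₁ x - v' x) * (b₁ (j x) - w' (j x)) :=
    Finset.sum_nonneg fun x _ => mul_nonneg (by linarith [h4 x]) (by linarith [k4 (j x)])
  have p2 : 0 ≤ ∑ x, (v x - a₀ x) * (w (j x) - b₀ (j x)) :=
    Finset.sum_nonneg fun x _ => mul_nonneg (by linarith [h1 x]) (by linarith [k1 (j x)])
  linarith

end AntitheticTwinRoot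

end Summit.CriticalPhenomena.PercolationContinuityZ3.Theorems
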